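import Summits.RiemannHypothesis.RiemannHypothesis.Theorems.PfPersistenceTransport
import Summits.RiemannHypothesis.RiemannHypothesis.Theorems.PfPersistenceParityTransport
import HarnessLib
import Summits.RiemannHypothesis.RiemannHypothesis.Theorems.WeilRouteProps.WeilGroundState
import Summits.RiemannHypothesis.RiemannHypothesis.Theorems.WeilRouteProps.WeilParity

/-!
# PF persistence — the Grönwall-transport inputs as NAMED HYPOTHESIS CLASSES (RULING A101 (a3))
(pub-rhpf barrier-typer gen 5; transport-1's leaf G1.22 TRANSPORT; MEMBERSHIP rows MONO-F|_(a ≤ 2.1), T-P|_served)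

**HONEST FRAMING. This is a long-odds MECHANISM SEARCH; no RH claims.** Statements + re-statements only; every
theorem below is a one-line re-statement of transport-1's landed `PfPersistenceTransport` / `PfPersistenceParityTransport`
theorems OVER the named defs (deprecate-and-add form; the def-free originals stay).  RULING A101: these are HYPOTHESIS
CLASSES (E1-placed, "not finitely determined", content only as `a → ∞`), NOT members of the admissible class `𝒞`;
MONO-F is RH-PLUS (CONJ), the generic rate bound is `⟺ RH` (tree `derivLeakage_iff_riemannHypothesis`), T-P is the
transport FORM of its target (not a weakening).  No "sub-RH progress" sentence may be derived from them.

* `RateBoundFrom a₀ K` / `ArchRateBoundFrom a₀` (MONO-F / T-B: `−ε′(a) ≤ 8π e^{2a} ε(a)` past the seed, i.e.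
  `a ↦ e^{4π e^{2a}} ε(a)` non-decreasing) — binders of `riemannHypothesis_of_rateBoundFrom` /
  `riemannHypothesis_of_archRateBoundFrom`, mirrored exactly; re-stated: `riemannHypothesis_of_archRateBoundFrom'`,
  `riemannHypothesis_of_rateBoundFrom'` (CONDITIONAL; RH is the conclusion of an explicit hypothesis, no RH claim).
* `SplittingLeakageFrom a₀` (T-P, Dini-leakage form of the parity splitting `Q = ε₋ − ε₊`) and
  `ArchSplittingTransportFrom c` (its integrated quasi-monotone form) — binders of
  `noParityCrossing_of_splittingLeakage` / `…_of_archSplittingTransport`; re-stated: `parity_of_splittingLeakageFrom`,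
  `parity_of_archSplittingTransportFrom` (CONDITIONAL).
-/

set_option linter.dupNamespace false

noncomputable section

open Real Set
open _root_.Literature.NumberTheory.LFunctions
open _root_.Summit.RiemannHypothesis.RiemannHypothesis.Theorems.WeilRouteProps.WeilParity (NoParityCrossing EvenWinsBeyondArch)
open _root_.Summit.RiemannHypothesis.RiemannHypothesis.Theorems.WeilRouteProps.WeilGroundState (GroundStateSimpleEven)

namespace Summit.RiemannHypothesis.RiemannHypothesis.Theorems.PfPersistence

/-- **TYPED — HYPOTHESIS CLASS (generic Grönwall rate, A101 (a3)):** past the seed `a₀`, wherever the continuum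
bottom `ε = weilGroundEnergy` is positive and differentiable, `−ε′(a) ≤ K(a)·ε(a)`.  For locally bounded `K` this is
`⟺ RH` (tree); it is an E1-type input, not a `𝒞` member. -/
def RateBoundFrom (a₀ : ℝ) (K : ℝ → ℝ) : Prop :=
  ∀ a : ℝ, a₀ ≤ a → 0 < weilGroundEnergy a → DifferentiableAt ℝ weilGroundEnergy a →
    -deriv weilGroundEnergy a ≤ K a * weilGroundEnergy a

/-- **TYPED — HYPOTHESIS CLASS `ArchRateBoundFrom a₀` (MONO-F / TRANSPORT.md T-B; RULING A101 (a3)):** the sharp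
archimedean member `K(a) = 8π e^{2a}`, i.e. `a ↦ e^{4π e^{2a}}·ε(a)` non-decreasing past the seed.  RH-PLUS (CONJ;
DATA law of record on `a ≤ 2.1`); mirrored verbatim from the binder of `riemannHypothesis_of_archRateBoundFrom`. -/
def ArchRateBoundFrom (a₀ : ℝ) : Prop :=
  ∀ a : ℝ, a₀ ≤ a → 0 < weilGroundEnergy a → DifferentiableAt ℝ weilGroundEnergy a →
    -deriv weilGroundEnergy a ≤ 8 * Real.pi * Real.exp (2 * a) * weilGroundEnergy a

/-- PROVED (rfl): `ArchRateBoundFrom` is the rate class at `K(a) = 8π e^{2a}`. [folklore] -/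
theorem archRateBoundFrom_iff (a₀ : ℝ) :
    ArchRateBoundFrom a₀ ↔ RateBoundFrom a₀ fun a => 8 * Real.pi * Real.exp (2 * a) := Iff.rfl

/-- PROVED — RE-STATED over the def (transport-1's `riemannHypothesis_of_rateBoundFrom`; CONDITIONAL: one seed below
`(log 3)/2` and a locally bounded rate bound ⇒ RH; no RH claim). [folklore] -/
theorem riemannHypothesis_of_rateBoundFrom' {a₀ : ℝ} (ha₀ : 0 < a₀) (ha₀' : a₀ < Real.log 3 / 2) {K : ℝ → ℝ}
    (hK : ∀ A : ℝ, ∃ M : ℝ, ∀ a : ℝ, a₀ ≤ a → a ≤ A → K a ≤ M) (h : RateBoundFrom a₀ K) :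
    _root_.RiemannHypothesis :=
  PfPersistenceTransport.riemannHypothesis_of_rateBoundFrom ha₀ ha₀' K hK h

/-- PROVED — RE-STATED over the def (transport-1's `riemannHypothesis_of_archRateBoundFrom`; CONDITIONAL, no RH
claim). [folklore] -/
theorem riemannHypothesis_of_archRateBoundFrom' {a₀ : ℝ} (ha₀ : 0 < a₀) (ha₀' : a₀ < Real.log 3 / 2)
    (h : ArchRateBoundFrom a₀) : _root_.RiemannHypothesis :=
  PfPersistenceTransport.riemannHypothesis_of_archRateBoundFrom ha₀ ha₀' h

/-- **TYPED — HYPOTHESIS CLASS `SplittingLeakageFrom a₀` (T-P, RULING A101 (a3)):** the Dini-leakage form of the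
parity splitting `Q(a) = ε₋(a) − ε₊(a)`: on every `[a₀, A)` some `K` bounds the right lower Dini drop of `Q` by
`K·Q + η`.  Mirrored verbatim (at `a₀ = 2/3`) from the binder of `noParityCrossing_of_splittingLeakage`; E1-type, the
transport FORM of its target, not a weakening. -/
def SplittingLeakageFrom (a₀ : ℝ) : Prop :=
  ∀ A : ℝ, a₀ ≤ A → ∃ K : ℝ, ∀ x ∈ Ico a₀ A, ∀ η δ : ℝ, 0 < η → 0 < δ →
    ∃ h : ℝ, 0 < h ∧ h < δ ∧
      (weilOddGroundEnergy x - weilEvenGroundEnergy x) -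
          (weilOddGroundEnergy (x + h) - weilEvenGroundEnergy (x + h)) ≤
        h * (K * (weilOddGroundEnergy x - weilEvenGroundEnergy x) + η)

/-- PROVED — RE-STATED over the def (transport-1's three `…_of_splittingLeakage` theorems; CONDITIONAL): the splitting
leakage from the PROVED frontier `2/3` gives `NoParityCrossing`, `GroundStateSimpleEven`, `EvenWinsBeyondArch`.
[folklore] -/
theorem parity_of_splittingLeakageFrom (h : SplittingLeakageFrom (2 / 3)) :
    NoParityCrossing ∧ GroundStateSimpleEven ∧ EvenWinsBeyondArch :=
  ⟨PfPersistenceParityTransport.noParityCrossing_of_splittingLeakage h,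
    PfPersistenceParityTransport.groundStateSimpleEven_of_splittingLeakage h,
    PfPersistenceParityTransport.evenWinsBeyondArch_of_splittingLeakage h⟩

/-- **TYPED — HYPOTHESIS CLASS `ArchSplittingTransportFrom c` (T-P, integrated quasi-monotone form):** the splitting
never drops below `c·Q(2/3)·e^{−4π(e^{2a} − e^{4/3})}` past `2/3`.  Mirrored verbatim from the binder of
`noParityCrossing_of_archSplittingTransport`. -/
def ArchSplittingTransportFrom (c : ℝ) : Prop :=
  ∀ a : ℝ, 2 / 3 ≤ a →
    c * (weilOddGroundEnergy (2 / 3) - weilEvenGroundEnergy (2 / 3)) *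
        Real.exp (-(4 * Real.pi * (Real.exp (2 * a) - Real.exp (2 * (2 / 3))))) ≤
      weilOddGroundEnergy a - weilEvenGroundEnergy a

/-- PROVED — RE-STATED over the def (transport-1's `noParityCrossing_of_archSplittingTransport`; CONDITIONAL).
[folklore] -/
theorem parity_of_archSplittingTransportFrom {c : ℝ} (hc : 0 < c) (h : ArchSplittingTransportFrom c) :
    NoParityCrossing ∧ GroundStateSimpleEven ∧ EvenWinsBeyondArch :=
  PfPersistenceParityTransport.noParityCrossing_of_archSplittingTransport hc h

end Summit.RiemannHypothesis.RiemannHypothesis.Theorems.PfPersistence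

end
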